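import Summits.MatrixMultiplication.OmegaCensus.SmallFormats.RankOnePlaneCapBlockLaw
import Literature.Computability.AlgebraicComplexity.LafonWinogradRankBound
import HarnessLib

/-!
# ω-census family (a): outputs killing a common space, the 'same' position of two saturated
column planes, and the `⟨2,1,2⟩` block dual-basis law

Cell `pub-omega` (unit `pub-omega-tensor`, gen 29), topic `Summits/MatrixMultiplication/OmegaCensus`
(sub-folder `SmallFormats`). Framing (verbatim): lottery ticket; floor = certified bounds/negative
ranges. HONEST FRAMING: three elementary consequences of the saturated column-plane law
`card_vanishing_col_eq_two_mul_sub` and of the Lafon–Winograd count `LafonWinograd.card_ge`, written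
out because the gauge-SAT instrument of the `𝔽₃` `⟨2,2,5⟩@17` X-marginal census (orbit 60420, the
356-orbit residue) uses them as DESK steps; here they become tree theorems. Not a bound on any rank,
not progress on `ω`.

* `lw_add_card_le_of_mulVec_eq_zero` — for a computation of `⟨c,m,n⟩` (`c ≥ 2`, `m ≥ 1`): if the
  outputs `W_i`, `i ∈ S`, all kill a subspace `E ≤ kⁿ` of dimension `e ≥ 1` (`W_i v = 0`, `v ∈ E`),
  then the other products compute `⟨c,m,e⟩` (pair the outputs with a basis of `E`), so
  `cm + m(e−1) + (e−1) + |S| ≤ r` (Lafon–Winograd). For `⟨2,2,n⟩`: `|S| + 3·dim E + 1 ≤ r`.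
* `false_of_sameF` — hence `4r − 12n` outputs cannot kill a common space of dimension `4n − r ≥ 1`:
  two disjoint SATURATED column planes (`|R₁| = |R₂| = 2r − 6n`) can never have all their
  `|R₁| + |R₂|` outputs with rows in the same `F′ = E₁^⊥` (`dim E₁ = 4n − r`) — the 'same' position
  of the gauge (`F′₁ = F′₂`), dropped on paper by tensor-g27's rank count, is impossible whenever
  `r < 4n` (`false_of_two_saturated_col_planes_sameF`; instance `_225`: `r = 17`, 8 outputs,
  `dim E₁ = 3`).
* `blockDual_of_card_eq` — for ONE saturated column plane `{z λᵀ}` (`θ ⊥ λ`, `E`, `F′ = E^⊥` as in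
  the law): the outputs `W_i`, `i ∈ R`, kill `E` (rows in `F′`); the X-forms factor as
  `f_i(X) = a_i · (Xθ)` with `a_i κ = f_i(e_κ θ'ᵀ)` (`θ'·θ = 1`); and with `b_i = θᵀ G_i` the
  `⟨2,1,2⟩` BLOCK DUAL-BASIS LAW holds: `a_i · (W_j b_i) = δ_ij` for `i, j ∈ R` — the outputs of the
  plane are the Frobenius-dual basis of the rank-one forms `a_i ⊗ b_i` on `k² ⊗ F′` (the premise of
  the '⟨2,1,2⟩ block split', stated but not proved in `RankOnePlaneCapBlockLaw`).
-/

namespace Summit.MatrixMultiplication.OmegaCensus.RankOnePlaneCapGeneral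

open Module Matrix Literature.Computability.AlgebraicComplexity

variable {k : Type*} [Field k] {c m n : ℕ} {ι : Type*} [Fintype ι]

/-! ### Outputs killing a common subspace -/

/-- A coordinate matrix `B` of a subspace `E ≤ kⁿ` of dimension `e` (columns = a basis of `E`)
together with a left inverse `C`, `C B = 1`. -/
theorem exists_colMatrix_leftInverse (E : Submodule k (Fin n → k)) {e : ℕ}
    (he : finrank k E = e) :
    ∃ (B : Matrix (Fin n) (Fin e) k) (C : Matrix (Fin e) (Fin n) k),
      C * B = 1 ∧ ∀ j, (fun ν => B ν j) ∈ E := by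
  classical
  let bE := Module.finBasisOfFinrankEq k E he
  let B : Matrix (Fin n) (Fin e) k := Matrix.of fun ν j => (bE j : Fin n → k) ν
  have hcol : ∀ j, (fun ν => B ν j) = (bE j : Fin n → k) := fun j => rfl
  have hmulVec : ∀ v : Fin e → k, B *ᵥ v = ((bE.equivFun.symm v : E) : Fin n → k) := by
    intro v
    rw [Basis.equivFun_symm_apply]
    ext ν
    simp only [B, Matrix.mulVec, dotProduct, Matrix.of_apply, Submodule.coe_sum,
      Submodule.coe_smul, Finset.sum_apply, Pi.smul_apply, smul_eq_mul]
    exact Finset.sum_congr rfl fun j _ => mul_comm _ _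
  have hinj : LinearMap.ker (Matrix.toLin' B) = ⊥ := by
    rw [LinearMap.ker_eq_bot]
    intro v w hvw
    rw [Matrix.toLin'_apply, Matrix.toLin'_apply, hmulVec, hmulVec] at hvw
    exact bE.equivFun.symm.injective (Subtype.ext hvw)
  obtain ⟨g, hg⟩ := LinearMap.exists_leftInverse_of_injective (Matrix.toLin' B) hinj
  refine ⟨B, LinearMap.toMatrix' g, ?_, fun j => hcol j ▸ (bE j).2⟩
  have h1 : LinearMap.toMatrix' (g ∘ₗ Matrix.toLin' B) = 1 := by
    rw [hg, LinearMap.toMatrix'_id]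
  rwa [LinearMap.toMatrix'_comp, LinearMap.toMatrix'_toLin'] at h1

/-- **Outputs killing a common space cost a Lafon–Winograd count.** If in a computation of
`⟨c,m,n⟩` (`c ≥ 2`, `m ≥ 1`) the outputs `W_i`, `i ∈ S`, all kill a subspace `E ≤ kⁿ` of dimension
`e ≥ 1`, then the remaining products compute `⟨c,m,e⟩` (`Y' ↦ Y' C`, `W ↦ W B` for a coordinate
matrix `B` of `E` with left inverse `C`), whence `cm + m(e−1) + (e−1) + |S| ≤ r`. -/
theorem lw_add_card_le_of_mulVec_eq_zero [DecidableEq ι] (hc : 2 ≤ c) (hm : 1 ≤ m)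
    (β : BilinComp (mulBilin k c m n) ι) (E : Submodule k (Fin n → k)) {e : ℕ}
    (he : finrank k E = e) (he1 : 1 ≤ e) (S : Finset ι)
    (hS : ∀ i ∈ S, ∀ v ∈ E, β.w i *ᵥ v = 0) :
    c * m + m * (e - 1) + (e - 1) + S.card ≤ Fintype.card ι := by
  classical
  obtain ⟨B, C, hCB, hBE⟩ := exists_colMatrix_leftInverse E he
  have hWB : ∀ i ∈ S, β.w i * B = 0 := by
    intro i hi
    ext a j
    have h := congrFun (hS i hi _ (hBE j)) a
    simpa [Matrix.mul_apply, Matrix.mulVec, dotProduct] using h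
  let β' : BilinComp (mulBilin k c m e) {i // i ∉ S} :=
    { f := fun i => β.f i.1
      g := fun i => (β.g i.1) ∘ₗ ((mulBilin k m e n).flip C)
      w := fun i => β.w i.1 * B
      map_eq_sum := fun X Y' => by
        have h := β.map_eq_sum X (Y' * C)
        rw [mulBilin_apply] at h
        simp only [LinearMap.coe_comp, Function.comp_apply, LinearMap.flip_apply, mulBilin_apply]
        have h2 : X * Y' = X * (Y' * C) * B := by
          rw [Matrix.mul_assoc, Matrix.mul_assoc, hCB, Matrix.mul_one]
        set F : ι → Matrix (Fin c) (Fin e) k :=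
          fun i => (β.f i X * β.g i (Y' * C)) • (β.w i * B) with hF
        have hzero : ∑ i ∈ S, F i = 0 := Finset.sum_eq_zero fun i hi => by
          rw [hF]; dsimp only; rw [hWB i hi, smul_zero]
        have hR : ∑ i ∈ Sᶜ, F i = ∑ i : {i // i ∉ S}, F i :=
          Finset.sum_subtype Sᶜ (fun i => Finset.mem_compl) F
        have hlhs : (∑ i, (β.f i X * β.g i (Y' * C)) • β.w i) * B = ∑ i, F i := by
          rw [Matrix.sum_mul]
          exact Finset.sum_congr rfl fun i _ => by rw [hF, Matrix.smul_mul]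
        rw [h2, h, hlhs]
        show ∑ i, F i = ∑ i : {i // i ∉ S}, F i.1
        rw [← Finset.sum_compl_add_sum S F, hzero, add_zero, hR] }
  have h := LafonWinograd.card_ge β' hc hm he1
  rw [Fintype.card_subtype_compl, Fintype.card_coe] at h
  have h2 : S.card ≤ Fintype.card ι := Finset.card_le_univ S
  omega

/-- `⟨2,2,n⟩` form: outputs `W_i`, `i ∈ S`, killing a common space `E ≠ 0` force
`|S| + 3·dim E + 1 ≤ r` (the others compute `⟨2,2,dim E⟩`, of length `≥ 3·dim E + 1`). -/
theorem card_add_three_mul_finrank_succ_le [DecidableEq ι] (β : BilinComp (mulBilin k 2 2 n) ι)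
    (E : Submodule k (Fin n → k)) (hE : 0 < finrank k E) (S : Finset ι)
    (hS : ∀ i ∈ S, ∀ v ∈ E, β.w i *ᵥ v = 0) :
    S.card + 3 * finrank k E + 1 ≤ Fintype.card ι := by
  have h := lw_add_card_le_of_mulVec_eq_zero (le_refl 2) (by norm_num) β E rfl hE S hS
  omega

/-- **The 'same' position is impossible.** In a computation of `⟨2,2,n⟩` of length `r < 4n`, no
`4r − 12n` outputs kill a common space of dimension `≥ 4n − r`. (Two disjoint saturated column planes
supply `|R₁| + |R₂| = 4r − 12n` outputs; 'same' means all of them have their rows in one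
`F′ = E^⊥` with `dim E = 4n − r`.) -/
theorem false_of_sameF [DecidableEq ι] (β : BilinComp (mulBilin k 2 2 n) ι)
    (hr : Fintype.card ι < 4 * n) (E : Submodule k (Fin n → k))
    (hE : 4 * n ≤ Fintype.card ι + finrank k E) (S : Finset ι)
    (hScard : 4 * Fintype.card ι ≤ 12 * n + S.card)
    (hS : ∀ i ∈ S, ∀ v ∈ E, β.w i *ᵥ v = 0) : False := by
  have hpos : 0 < finrank k E := by omega
  have h := card_add_three_mul_finrank_succ_le β E hpos S hS
  omega

/-! ### Rows in `F′`: the outputs of a saturated plane kill `E` -/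

omit [Fintype ι] in
/-- From the Frobenius-orthogonality characterisation of the saturated law
(`∀ Y', (∀ i ∈ R, ⟨W_i, Y'⟩ = 0) ↔ rows of Y' ⊆ E`): every output `W_i`, `i ∈ R`, kills `E`,
i.e. has all its rows in `F′ = E^⊥`. -/
theorem mulVec_eq_zero_of_orth_iff {W : ι → Matrix (Fin c) (Fin n) k} (R : Finset ι)
    (E : Submodule k (Fin n → k))
    (hchar : ∀ Y' : Matrix (Fin c) (Fin n) k,
      (∀ i ∈ R, (∑ κ, ∑ ν, W i κ ν * Y' κ ν) = 0) ↔ ∀ κ, Y' κ ∈ E)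
    {i : ι} (hi : i ∈ R) {v : Fin n → k} (hv : v ∈ E) : W i *ᵥ v = 0 := by
  classical
  ext κ₀
  let Y' : Matrix (Fin c) (Fin n) k := Matrix.of fun κ ν => if κ = κ₀ then v ν else 0
  have hY' : ∀ κ, Y' κ ∈ E := by
    intro κ
    by_cases h : κ = κ₀
    · have : Y' κ = v := funext fun ν => by simp [Y', h]
      rw [this]; exact hv
    · have : Y' κ = 0 := funext fun ν => by simp [Y', h]
      rw [this]; exact E.zero_mem
  have h := (hchar Y').mpr hY' i hi
  rw [Finset.sum_eq_single κ₀ (fun κ _ hκ => by simp [Y', hκ])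
    (fun h => absurd (Finset.mem_univ _) h)] at h
  simpa [Y', Matrix.mulVec, dotProduct] using h

/-- **Two saturated column planes are never in the 'same' position.** If `R₁` (saturated:
`|R₁| + 6n = 2r`, with the law's space `E₁`, `dim E₁ + 2n = |R₁ᶜ|`, and its orthogonality
characterisation) and a disjoint `R₂` with `|R₂| + 6n = 2r` whose outputs ALSO kill `E₁` (i.e. have
their rows in the same `F′₁ = E₁^⊥`) coexist, then `r ≥ 4n`. For `(n,r) = (5,17)` this is the
'same' case `F′₁ = F′₂` of the gauge, excluded. -/
theorem false_of_two_saturated_col_planes_sameF [DecidableEq ι] (β : BilinComp (mulBilin k 2 2 n) ι)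
    (hr : Fintype.card ι < 4 * n) (R₁ R₂ : Finset ι) (hdisj : Disjoint R₁ R₂)
    (hcard₁ : R₁.card + 6 * n = 2 * Fintype.card ι) (hcard₂ : R₂.card + 6 * n = 2 * Fintype.card ι)
    (E₁ : Submodule k (Fin n → k)) (hdim₁ : finrank k E₁ + 2 * n = (Finset.univ \ R₁).card)
    (hchar₁ : ∀ Y' : Matrix (Fin 2) (Fin n) k,
      (∀ i ∈ R₁, (∑ κ, ∑ ν, β.w i κ ν * Y' κ ν) = 0) ↔ ∀ κ, Y' κ ∈ E₁)
    (hR₂ : ∀ i ∈ R₂, ∀ v ∈ E₁, β.w i *ᵥ v = 0) : False := by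
  have hcR : (Finset.univ \ R₁).card + R₁.card = Fintype.card ι := by
    rw [Finset.card_sdiff_add_card_eq_card (Finset.subset_univ R₁), Finset.card_univ]
  refine false_of_sameF β hr E₁ (by omega) (R₁ ∪ R₂) ?_ ?_
  · rw [Finset.card_union_of_disjoint hdisj]; omega
  · intro i hi v hv
    rcases Finset.mem_union.mp hi with h | h
    · exact mulVec_eq_zero_of_orth_iff R₁ E₁ hchar₁ h hv
    · exact hR₂ i h v hv

/-- `(n,r) = (5,17)` instance (the `𝔽₃` `⟨2,2,5⟩@17` census; any field): two disjoint saturated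
column planes (`|R₁| = |R₂| = 4`, `dim E₁ = 3`) are never in the 'same' position `F′₁ = F′₂`
(all eight outputs with rows in `E₁^⊥`). -/
theorem false_of_two_saturated_col_planes_sameF_225 [DecidableEq ι] (h17 : Fintype.card ι = 17)
    (β : BilinComp (mulBilin k 2 2 5) ι) (R₁ R₂ : Finset ι) (hdisj : Disjoint R₁ R₂)
    (hcard₁ : R₁.card = 4) (hcard₂ : R₂.card = 4)
    (E₁ : Submodule k (Fin 5 → k)) (hdim₁ : finrank k E₁ = 3)
    (hchar₁ : ∀ Y' : Matrix (Fin 2) (Fin 5) k,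
      (∀ i ∈ R₁, (∑ κ, ∑ ν, β.w i κ ν * Y' κ ν) = 0) ↔ ∀ κ, Y' κ ∈ E₁)
    (hR₂ : ∀ i ∈ R₂, ∀ v ∈ E₁, β.w i *ᵥ v = 0) : False := by
  have hc : (Finset.univ \ R₁).card + R₁.card = Fintype.card ι := by
    rw [Finset.card_sdiff_add_card_eq_card (Finset.subset_univ R₁), Finset.card_univ]
  exact false_of_two_saturated_col_planes_sameF β (by omega) R₁ R₂ hdisj (by omega) (by omega) E₁
    (by omega) hchar₁ hR₂

/-! ### The `⟨2,1,2⟩` block dual-basis law of one saturated column plane -/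

/-- A matrix is the sum of its rows placed by the unit vectors: `M = ∑_κ e_κ (M κ)ᵀ`. -/
theorem eq_sum_vecMulVec_single_row (M : Matrix (Fin c) (Fin n) k) :
    M = ∑ κ, vecMulVec (Pi.single κ (1 : k)) (M κ) := by
  ext a ν
  rw [Matrix.sum_apply, Finset.sum_eq_single a (fun κ _ hκ => by simp [vecMulVec_apply, hκ.symm])
    (fun h => absurd (Finset.mem_univ _) h)]
  simp [vecMulVec_apply]

/-- **Block dual-basis law of a saturated column plane** (`⟨2,2,n⟩`). If exactly `|R| = 2r − 6n`
X-forms vanish on `{z λᵀ}` (`λ ≠ 0`), then with `θ ≠ 0`, `θ ⊥ λ`, `θ'` with `θ'·θ = 1`, the law's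
`E = span{θᵀG_i : i ∉ R}` (`dim E = |Rᶜ| − 2n`):
* the outputs `W_i`, `i ∈ R`, are linearly independent and kill `E` (rows in `F′ = E^⊥`);
* the X-forms factor through `X ↦ Xθ`: `f_i(X) = a_i · (Xθ)` with `a_i κ = f_i(e_κ θ'ᵀ)` (`i ∈ R`);
* DUAL BASIS: `a_i · (W_j b_i) = δ_ij` for `i, j ∈ R`, where `b_i = θᵀG_i` (`G_i μ ν = g_i(E_{μν})`).
(So on `k² ⊗ F′` the `|R|` rank-one forms `a_i ⊗ b_i` and the outputs `W_i` are dual bases: the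
`R`-terms are a minimal computation of the outer product `(Xθ) ⊗ w`, `w ∈ F′`.) -/
theorem blockDual_of_card_eq [DecidableEq ι] (β : BilinComp (mulBilin k 2 2 n) ι)
    {lam : Fin 2 → k} (hlam : lam ≠ 0) (R : Finset ι)
    (hR : ∀ i ∈ R, ∀ z : Fin 2 → k, β.f i (vecMulVec z lam) = 0)
    (heq : R.card + 6 * n = 2 * Fintype.card ι) :
    ∃ (θ θ' : Fin 2 → k) (E : Submodule k (Fin n → k)),
      θ ≠ 0 ∧ θ ⬝ᵥ lam = 0 ∧ θ' ⬝ᵥ θ = 1 ∧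
      E = Submodule.span k
        ((fun i => θ ᵥ* Matrix.of fun μ ν => β.g i (Matrix.single μ ν (1 : k))) ''
          ↑(Finset.univ \ R)) ∧
      finrank k E + 2 * n = (Finset.univ \ R).card ∧
      LinearIndependent k (fun i : {i // i ∈ R} => β.w i.1) ∧
      (∀ i ∈ R, ∀ v ∈ E, β.w i *ᵥ v = 0) ∧
      (∀ i ∈ R, ∀ X : Matrix (Fin 2) (Fin 2) k,
        β.f i X = (fun κ => β.f i (vecMulVec (Pi.single κ (1 : k)) θ')) ⬝ᵥ (X *ᵥ θ)) ∧
      (∀ i ∈ R, ∀ j ∈ R,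
        (fun κ => β.f i (vecMulVec (Pi.single κ (1 : k)) θ')) ⬝ᵥ
            (β.w j *ᵥ (θ ᵥ* Matrix.of fun μ ν => β.g i (Matrix.single μ ν (1 : k))))
          = if i = j then 1 else 0) := by
  classical
  obtain ⟨θ, E, hθ, hθlam, hE, hdim, hchar, hli⟩ :=
    card_vanishing_col_eq_two_mul_sub β hlam R hR heq
  -- `θ'` with `θ' · θ = 1`
  obtain ⟨j₀, hj₀⟩ : ∃ j, θ j ≠ 0 := by
    by_contra h0
    simp only [not_exists, not_not] at h0
    exact hθ (funext h0)
  set θ' : Fin 2 → k := Pi.single j₀ (θ j₀)⁻¹ with hθ'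
  have hθ'θ : θ' ⬝ᵥ θ = 1 := by
    rw [hθ', single_dotProduct, inv_mul_cancel₀ hj₀]
  -- the outputs of `R` kill `E`
  have hW : ∀ i ∈ R, ∀ v ∈ E, β.w i *ᵥ v = 0 := fun i hi v hv =>
    mulVec_eq_zero_of_orth_iff R E hchar hi hv
  -- the Y-side: `g_i(θ wᵀ) = b_i · w`
  have hb : ∀ (i : ι) (w : Fin n → k), β.g i (vecMulVec θ w) =
      (θ ᵥ* Matrix.of fun μ ν => β.g i (Matrix.single μ ν (1 : k))) ⬝ᵥ w :=
    fun i w => dual_apply_vecMulVec _ _ _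
  -- X-side factorisation `f_i(X) = a_i · (Xθ)`
  have hfac : ∀ i ∈ R, ∀ X : Matrix (Fin 2) (Fin 2) k,
      β.f i X = (fun κ => β.f i (vecMulVec (Pi.single κ (1 : k)) θ')) ⬝ᵥ (X *ᵥ θ) := by
    intro i hi X
    have hX : X *ᵥ θ = vecMulVec (X *ᵥ θ) θ' *ᵥ θ := by
      rw [vecMulVec_mulVec, hθ'θ]
      simp
    rw [dual_apply_eq_of_mulVec_eq hθ hlam hθlam (β.f i) (hR i hi) hX]
    have hsum : vecMulVec (X *ᵥ θ) θ' =
        ∑ κ, (X *ᵥ θ) κ • vecMulVec (Pi.single κ (1 : k)) θ' := by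
      ext a' b'
      rw [Matrix.sum_apply, Finset.sum_eq_single a'
        (fun κ _ hκ => by simp [vecMulVec_apply, hκ.symm]) (fun h => absurd (Finset.mem_univ _) h)]
      simp [vecMulVec_apply]
    rw [hsum, map_sum, dotProduct]
    refine Finset.sum_congr rfl fun κ _ => ?_
    rw [map_smul, smul_eq_mul, mul_comm]
  -- the restricted Brent identity on `Y = θ wᵀ`, `w ⊥ E`
  have hvan : ∀ w : Fin n → k, (∀ e ∈ E, e ⬝ᵥ w = 0) →
      ∀ i ∈ Finset.univ \ R, β.g i (vecMulVec θ w) = 0 := by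
    intro w hw i hi
    rw [hb]
    apply hw
    rw [hE]
    exact Submodule.subset_span ⟨i, Finset.mem_coe.mpr hi, rfl⟩
  have hBrent : ∀ w : Fin n → k, (∀ e ∈ E, e ⬝ᵥ w = 0) → ∀ X : Matrix (Fin 2) (Fin 2) k,
      X * vecMulVec θ w = ∑ i ∈ R, (β.f i X * β.g i (vecMulVec θ w)) • β.w i := by
    intro w hw X
    have h := β.map_eq_sum X (vecMulVec θ w)
    rw [mulBilin_apply] at h
    rw [h, ← Finset.sum_sdiff (Finset.subset_univ R),
      Finset.sum_eq_zero (fun i hi => by rw [hvan w hw i hi, mul_zero, zero_smul]), zero_add]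
  refine ⟨θ, θ', E, hθ, hθlam, hθ'θ, hE, hdim, hli, hW, hfac, ?_⟩
  -- dual basis
  intro i hi j hj
  -- the rows of `W_j` lie in `F′ = E^⊥`
  have hrow : ∀ κ, ∀ e ∈ E, e ⬝ᵥ β.w j κ = 0 := by
    intro κ e he
    have h := congrFun (hW j hj e he) κ
    simp only [Matrix.mulVec, Pi.zero_apply] at h
    rw [dotProduct_comm]; exact h
  have hXκ : ∀ κ : Fin 2, vecMulVec (Pi.single κ (1 : k)) θ' * vecMulVec θ (β.w j κ)
      = vecMulVec (Pi.single κ (1 : k)) (β.w j κ) := by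
    intro κ
    rw [vecMulVec_mul_vecMulVec, hθ'θ, one_smul]
  -- expand `W_j = ∑_κ e_κ (W_j κ)ᵀ` and apply the restricted identity row by row
  set coef : ι → k := fun i' => ∑ κ, β.f i' (vecMulVec (Pi.single κ (1 : k)) θ') *
    β.g i' (vecMulVec θ (β.w j κ)) with hcoef
  have hexp : β.w j = ∑ i' ∈ R, coef i' • β.w i' := by
    calc β.w j = ∑ κ, vecMulVec (Pi.single κ (1 : k)) (β.w j κ) := eq_sum_vecMulVec_single_row _
      _ = ∑ κ, ∑ i' ∈ R, (β.f i' (vecMulVec (Pi.single κ (1 : k)) θ') *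
            β.g i' (vecMulVec θ (β.w j κ))) • β.w i' := by
          refine Finset.sum_congr rfl fun κ _ => ?_
          rw [← hXκ κ, hBrent (β.w j κ) (hrow κ)]
      _ = ∑ i' ∈ R, ∑ κ, (β.f i' (vecMulVec (Pi.single κ (1 : k)) θ') *
            β.g i' (vecMulVec θ (β.w j κ))) • β.w i' := Finset.sum_comm
      _ = ∑ i' ∈ R, coef i' • β.w i' := by
          refine Finset.sum_congr rfl fun i' _ => ?_
          rw [← Finset.sum_smul]
  -- the trivial expansion `W_j = ∑ δ_{i'j} W_{i'}`
  have hδ : ∑ i' ∈ R, (if i' = j then (1 : k) else 0) • β.w i' = β.w j := by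
    simp only [ite_smul, one_smul, zero_smul, Finset.sum_ite_eq', if_pos hj]
  have hzero : ∑ i' ∈ R, (coef i' - if i' = j then 1 else 0) • β.w i' = 0 := by
    simp only [sub_smul, Finset.sum_sub_distrib, hδ, ← hexp, sub_self]
  -- linear independence of the outputs of `R`
  have hli' := hli
  rw [Fintype.linearIndependent_iff] at hli'
  have hsub : ∑ i' : {i' // i' ∈ R}, (coef i'.1 - if i'.1 = j then 1 else 0) • β.w i'.1 = 0 := by
    rw [← hzero]
    exact (Finset.sum_subtype R (fun _ => Iff.rfl)
      (fun i' => (coef i' - if i' = j then 1 else 0) • β.w i')).symm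
  have h := hli' (fun i' => coef i'.1 - if i'.1 = j then 1 else 0) hsub ⟨i, hi⟩
  have hci : coef i = if i = j then 1 else 0 := sub_eq_zero.mp h
  rw [← hci, hcoef]
  simp only [hb, dotProduct, Matrix.mulVec, mul_comm]

end Summit.MatrixMultiplication.OmegaCensus.RankOnePlaneCapGeneral
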